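import Literature.AlgebraicGeometry.HodgeTheory.IsoTransport
import Literature.AlgebraicGeometry.Motives.FermatHypersurface
import Literature.AlgebraicGeometry.Motives.CurveNet
import HarnessLib

/-!
# The Fermat variety up to isomorphism: statements about Hodge classes reduce to the standard model `V₊(Σ xᵢᵐ) ⊂ ℙⁿ⁺¹_ℂ`

Family `hodge`, layer `Literature/AlgebraicGeometry/HodgeTheory`. The named fact
`hodgeClasses_algebraic_fermat` (file `FermatHodgeConjecture`; Shioda, Proc. Japan Acad. 55A (1979)
§2 Thm. 1; Ran, Compositio Math. 42 (1980) Thm. 4.9) and the routes attacking it quantify over ALL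
`ℂ`-schemes `X` with `Motives.IsFermatVariety n m X` (reduced, closed-immersed onto
`V₊(x₀ᵐ + ⋯ + x_{n+1}ᵐ) ⊂ ℙⁿ⁺¹_ℂ`) and `Motives.IsSmoothProjective n X`, whereas the symmetry group
`μₘⁿ⁺²`, its character eigenspaces `fermatEigenspace m α k` (`FermatDiagonalAction`) and every
explicit cycle live on the STANDARD MODEL
`X_F = Motives.SmoothHypersurface.hypersurface (fermatPolynomial ℂ n m)` (named `fermatHypersurface n m`,
an `abbrev`, in `FermatHypersurfaceReduction`). This file PROVES, with a light import cone, that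
the two formulations are equivalent degree by degree:

* `isSmoothProjective_of_isFermatVariety_iff`: some (equivalently every) smooth projective Fermat
  variety `Xⁿₘ` exists iff the standard model is smooth projective (`Motives.IsSmoothProjective.of_iso`
  along `X ≅ X_F`, `Motives.IsFermatVariety.nonempty_iso_hypersurface`); for `n, m ≥ 1` both hold
  (`Motives.SmoothHypersurface.isSmoothProjective_hypersurface_fermatPolynomial_of_charZero`);
* `forall_isFermatVariety_hodgeClass_mem_algebraicClasses_iff`: **every rational class of Hodge type
  `(p, p)` in `H²ᵖ(X(ℂ); ℂ)` is algebraic for EVERY smooth projective Fermat variety `X = Xⁿₘ` iff this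
  holds for the standard model** (granted it is smooth projective) — transport of the three
  predicates along `e : X ≅ X_F` (`forall_hodgeClass_mem_algebraicClasses_iff_of_iso`, file
  `IsoTransport`: `e^*` is a bijection preserving rationality, Hodge type and the support
  filtration); and the hypothesis-free corollary for `n, m ≥ 1`,
  `forall_isFermatVariety_hodgeClass_mem_algebraicClasses_iff_of_pos`.

This is the transport step of `hodgeClasses_algebraic_fermat_middle_of_fermatHypersurface`
(`FermatHypersurfaceReduction`, whose imports carry the named facts of `FermatHodgeConjectureProofs`,
`HodgeConjectureQbarVoisinProofs` and `ComplexConjugation`) in `iff` form and in every degree, with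
imports `IsoTransport`, `Motives/FermatHypersurface`, `Motives/CurveNet` only (no named fact beyond
the cone of `Summits/HodgeConjecture/HodgeConjecture/Statement.lean`; work item
`defn-FermatLayerConeLightRehome`).

## References

* [Shioda1979PJA] T. Shioda, The Hodge conjecture and the Tate conjecture for Fermat varieties,
  Proc. Japan Acad. 55A (1979) 111–114, §1 eq. (1), §2 Thm. 1.
* [Hartshorne1977] R. Hartshorne, Algebraic Geometry (1977), II Ex. 3.11 (d).
* [GrothendieckTopology1969] A. Grothendieck, Topology 8 (1969), §1.
-/

noncomputable section

open CategoryTheory AlgebraicGeometry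

namespace Literature.AlgebraicGeometry.HodgeTheory

open Literature.AlgebraicGeometry.Motives

section HodgeTheory

variable {n m : ℕ}

/-- **Smooth projectivity of Fermat varieties is decided by the standard model**: a smooth
projective `X` with `IsFermatVariety n m X` exists iff the standard model `V₊(Σ xᵢᵐ)` is smooth
projective of dimension `n` (every Fermat variety is isomorphic to it, and smooth projectivity
transports along isomorphisms). [cite: Hartshorne1977, II Ex. 3.11 (d)] -/
theorem exists_isFermatVariety_isSmoothProjective_iff :
    (∃ X : SchemeOver ℂ, IsFermatVariety n m X ∧ IsSmoothProjective n X) ↔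
      IsSmoothProjective n (SmoothHypersurface.hypersurface (fermatPolynomial ℂ n m)) := by
  refine ⟨fun ⟨X, hF, hX⟩ ↦ ?_, fun h ↦
    ⟨_, SmoothHypersurface.isFermatVariety_hypersurface_fermatPolynomial ℂ n m, h⟩⟩
  obtain ⟨e⟩ := hF.nonempty_iso_hypersurface
  exact hX.of_iso e

/-- A smooth projective Fermat variety `Xⁿₘ` forces the standard model to be smooth projective.
[cite: Hartshorne1977, II Ex. 3.11 (d)] -/
theorem isSmoothProjective_hypersurface_of_isFermatVariety {X : SchemeOver ℂ} (hF : IsFermatVariety n m X)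
    (hX : IsSmoothProjective n X) :
    IsSmoothProjective n (SmoothHypersurface.hypersurface (fermatPolynomial ℂ n m)) :=
  exists_isFermatVariety_isSmoothProjective_iff.1 ⟨X, hF, hX⟩

/-- **Hodge classes on Fermat varieties: reduction to the standard model, degree by degree.**
Granted that the standard model `X_F = V₊(Σᵢ xᵢᵐ) ⊂ ℙⁿ⁺¹_ℂ` is smooth projective of dimension `n`,
every rational class of Hodge type `(p, p)` in `H²ᵖ(X(ℂ); ℂ)` is algebraic for EVERY smooth
projective `X` with `IsFermatVariety n m X` iff this holds for `X_F`: `X ≅ X_F` over `ℂ`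
(uniqueness of the reduced induced structure) and rationality, Hodge type and algebraicity are
invariant under pull-back along an isomorphism (`forall_hodgeClass_mem_algebraicClasses_iff_of_iso`).
This is the shape of the hypothesis `hmid` of `hodgeClasses_algebraic_fermat_of_middle` versus the
standard-model statements of the eigenspace files. [cite: Shioda1979PJA, §2 Thm. 1]
[cite: Hartshorne1977, II Ex. 3.11 (d)] [cite: GrothendieckTopology1969, §1] -/
theorem forall_isFermatVariety_hodgeClass_mem_algebraicClasses_iff
    (hstd : IsSmoothProjective n (SmoothHypersurface.hypersurface (fermatPolynomial ℂ n m))) (p : ℕ) :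
    (∀ ⦃X : SchemeOver ℂ⦄, IsFermatVariety n m X → IsSmoothProjective n X →
        ∀ c : complexBetti X (2 * p), IsRationalClass c → IsOfHodgeType n X (2 * p) p p c →
          c ∈ algebraicClasses X p) ↔
      ∀ c : complexBetti (SmoothHypersurface.hypersurface (fermatPolynomial ℂ n m)) (2 * p),
        IsRationalClass c →
          IsOfHodgeType n (SmoothHypersurface.hypersurface (fermatPolynomial ℂ n m)) (2 * p) p p c →
            c ∈ algebraicClasses (SmoothHypersurface.hypersurface (fermatPolynomial ℂ n m)) p := by
  refine ⟨fun h ↦ h (SmoothHypersurface.isFermatVariety_hypersurface_fermatPolynomial ℂ n m) hstd,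
    fun h X hF _ ↦ ?_⟩
  obtain ⟨e⟩ := hF.nonempty_iso_hypersurface
  exact (forall_hodgeClass_mem_algebraicClasses_iff_of_iso (n := n) e p).2 h

/-- **The same for `n ≥ 1`, `m ≥ 1`, where the standard model IS smooth projective**
(`isSmoothProjective_hypersurface_fermatPolynomial_of_charZero`): rational `(p, p)`-classes are
algebraic on every smooth projective Fermat variety `Xⁿₘ` iff they are on `V₊(Σᵢ xᵢᵐ)`.
[cite: Shioda1979PJA, §2 Thm. 1] [cite: Hartshorne1977, I Ex. 5.5 and II Example 8.20.2] -/
theorem forall_isFermatVariety_hodgeClass_mem_algebraicClasses_iff_of_pos (hn : 1 ≤ n) (hm : 1 ≤ m)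
    (p : ℕ) :
    (∀ ⦃X : SchemeOver ℂ⦄, IsFermatVariety n m X → IsSmoothProjective n X →
        ∀ c : complexBetti X (2 * p), IsRationalClass c → IsOfHodgeType n X (2 * p) p p c →
          c ∈ algebraicClasses X p) ↔
      ∀ c : complexBetti (SmoothHypersurface.hypersurface (fermatPolynomial ℂ n m)) (2 * p),
        IsRationalClass c →
          IsOfHodgeType n (SmoothHypersurface.hypersurface (fermatPolynomial ℂ n m)) (2 * p) p p c →
            c ∈ algebraicClasses (SmoothHypersurface.hypersurface (fermatPolynomial ℂ n m)) p :=
  forall_isFermatVariety_hodgeClass_mem_algebraicClasses_iff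
    (SmoothHypersurface.isSmoothProjective_hypersurface_fermatPolynomial_of_charZero hn hm) p

/-- **Any single predicate invariant under isomorphism reduces to the standard model.** For a
property `P` of `ℂ`-schemes stable under isomorphism, `P` holds for every Fermat variety `Xⁿₘ` iff
it holds for `V₊(Σᵢ xᵢᵐ)` (e.g. `P X = (fermat-type statement about Hᵏ(X(ℂ); ℂ))` transported by
`IsoTransport`). [cite: Hartshorne1977, II Ex. 3.11 (d)] -/
theorem forall_isFermatVariety_iff_of_iso_invariant {P : SchemeOver ℂ → Prop}
    (hP : ∀ ⦃X X' : SchemeOver ℂ⦄, (X ≅ X') → P X → P X') :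
    (∀ ⦃X : SchemeOver ℂ⦄, IsFermatVariety n m X → P X) ↔
      P (SmoothHypersurface.hypersurface (fermatPolynomial ℂ n m)) := by
  refine ⟨fun h ↦ h (SmoothHypersurface.isFermatVariety_hypersurface_fermatPolynomial ℂ n m),
    fun h X hF ↦ ?_⟩
  obtain ⟨e⟩ := hF.nonempty_iso_hypersurface
  exact hP e.symm h

end HodgeTheory

end Literature.AlgebraicGeometry.HodgeTheory

end
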